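import Summits.HubbardSuperconductivity.HubbardSuperconductivity.Theorems.DeformationLadderLowEnergyRigidityStubTopPoincare
import Summits.HubbardSuperconductivity.HubbardSuperconductivity.Theorems.DeformationLadderLowEnergyRigidityStubChain
import Summits.HubbardSuperconductivity.HubbardSuperconductivity.Theorems.DeformationLadderLowEnergyRigidityTelescopeNormalForms

/-!
# Route `DeformationLadder`, crux `LowEnergyRigidity` (item `stmt-HubbardSuperconductivity-1892`):
# the Poincaré telescope — the reduction (crux matrix at `(U, δ)` from the two open inputs)

Support file (`--supports stmt-HubbardSuperconductivity-1892`) for the line `Sketch` (poincare-telescope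
spine), stub `stub_reduction`. It closes the telescope: from the landed top step `stub_topPoincare`
(`16 Re⟨𝒞₄⟩ − 8 Re⟨𝒟₄⟩ ≤ Re⟨Δ_dᴴΔ_d⟩`, module `…StubTopPoincare`) and the landed dyadic chain `stub_chain`
(`ρ_{4·2^m} ≤ ρ₄ + E/(96J) + C·4·2^m/L`, module `…StubChain`), the two OPEN inputs of the card at a point
`(U, δ)` —
* `JosephsonInequalityAt U δ J C ℓ₁` for some rate `J > 0`, slack constant `C`, bottom scale `ℓ₁ > 0`
  (the `O(1)` stiffness content), and
* `CoherenceFloorAt U δ r₀ ℓ₀` with one floor `r₀ > 0` on an unbounded set of lattice scales `ℓ₀`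
  (the thermodynamic content) —
imply the MATRIX of the crux `LowEnergyRigidity` at that point: there are `κ > 0`, `a > 0`, `L₀` such that
every unit vector of the sector `szSector (2⌊(1-δ)L²/2⌋) 0` with `Re⟨φ, H_L φ⟩ ≤ minEnergyOn + κ` has
`a ≤ L⁻⁴ Re⟨φ, Δ_dᴴΔ_d φ⟩`, for all even `L ≥ L₀` (`H_L = hubbardTorus 2 L 1 U`). Witnesses: `κ = 3 J r₀`,
`a = r₀/8`; the budget is `LRO ≥ (r₀ − ε) − κ/(24J) − C⁺/ℓ₀ − 2C⁺/L` with `ε = r₀/8`, `C⁺ = max C 0`,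
`C⁺/ℓ₀ ≤ r₀/2`, `2C⁺/L ≤ r₀/8` (card budget `a = r₀ − ε − κ/(24J) − C/ℓ₀ − o(1)`).

Contents: `exists_dyadic_window` (the bottom cell count `4·2^m` with `4·2^m·ℓ₀ ≤ L < 2·(4·2^m)·ℓ₀`),
`josephsonInequalityAt_mono_slack` (a larger slack constant is a weaker Josephson family),
`budget_arith` (the budget over plain reals), `stub_reduction` (registered signature), and the named
corollary `lowEnergyRigidity_of_josephson_of_floor : 0 < U → δ ∈ Ioo 0 (1/2) → … → LowEnergyRigidity`
(the crux BY NAME). All elementary [folklore]; source of the construction: idea card poincare-telescope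
(ideator 3, 2026-08-16), `Cruxes/LowEnergyRigidity/Ideas/poincare-telescope.md`.
-/

noncomputable section

namespace Summit.HubbardSuperconductivity.HubbardSuperconductivity.Theorems.LowEnergyRigidity.Telescope

set_option linter.dupNamespace false -- summit = problem name (single-conjunct summit), D-0017

open Matrix
open scoped ComplexOrder
open Literature.MathematicalPhysics.QuantumLattice Literature.Probability.LatticeModels
open Summit.HubbardSuperconductivity.HubbardSuperconductivity.Theses.DeformationLadder
open Summit.HubbardSuperconductivity.HubbardSuperconductivity.Theorems (minEnergyOn_le_re_rayleigh)

/-! ### Bookkeeping -/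

/-- Dyadic bottom window: for `0 < ℓ₀` and `4 ℓ₀ ≤ L` there is `m` with
`4·2^m·ℓ₀ ≤ L < 2·(4·2^m)·ℓ₀` (take `m = log₂ ⌊L/(4ℓ₀)⌋`). [folklore] -/
theorem exists_dyadic_window {ℓ₀ L : ℕ} (hℓ : 0 < ℓ₀) (hL : 4 * ℓ₀ ≤ L) :
    ∃ m : ℕ, 4 * 2 ^ m * ℓ₀ ≤ L ∧ L < 2 * (4 * 2 ^ m) * ℓ₀ := by
  have h4 : 0 < 4 * ℓ₀ := by omega
  set q := L / (4 * ℓ₀) with hq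
  have hq1 : 1 ≤ q := by
    rw [hq, Nat.one_le_div_iff h4]; exact hL
  refine ⟨Nat.log 2 q, ?_, ?_⟩
  · have h1 : 2 ^ Nat.log 2 q ≤ q := Nat.pow_log_le_self 2 (by omega)
    have h2 : q * (4 * ℓ₀) ≤ L := Nat.div_mul_le_self L (4 * ℓ₀)
    calc 4 * 2 ^ Nat.log 2 q * ℓ₀ = 2 ^ Nat.log 2 q * (4 * ℓ₀) := by ring
      _ ≤ q * (4 * ℓ₀) := Nat.mul_le_mul_right _ h1
      _ ≤ L := h2
  · have h1 : q < 2 ^ (Nat.log 2 q + 1) := Nat.lt_pow_succ_log_self (by norm_num) q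
    have h2 : L < 4 * ℓ₀ * (q + 1) := by
      rw [hq]; exact Nat.lt_mul_div_succ L h4
    have h3 : q + 1 ≤ 2 ^ (Nat.log 2 q + 1) := h1
    calc L < 4 * ℓ₀ * (q + 1) := h2
      _ ≤ 4 * ℓ₀ * 2 ^ (Nat.log 2 q + 1) := Nat.mul_le_mul_left _ h3
      _ = 2 * (4 * 2 ^ Nat.log 2 q) * ℓ₀ := by ring

/-- Monotonicity of the Josephson family in the slack constant: for `0 < J` and `C ≤ C'`,
`JosephsonInequalityAt U δ J C ℓ₀ → JosephsonInequalityAt U δ J C' ℓ₀` (a larger slack is a weaker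
statement); in particular one may pass to `max C 0 ≥ 0`. [folklore] -/
theorem josephsonInequalityAt_mono_slack {U δ J C C' : ℝ} {ℓ₀ : ℕ} (hJ : 0 < J) (hCC' : C ≤ C')
    (h : JosephsonInequalityAt U δ J C ℓ₀) : JosephsonInequalityAt U δ J C' ℓ₀ := by
  obtain ⟨L₀, h⟩ := h
  refine ⟨L₀, fun L _ hL hev k _ hk hkl φ hφK hφ1 => ?_⟩
  have h1 := h L hL hev k hk hkl φ hφK hφ1
  have hmono : C * J * (k : ℝ) ^ 3 / (L : ℝ) ≤ C' * J * (k : ℝ) ^ 3 / (L : ℝ) := by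
    apply div_le_div_of_nonneg_right _ (Nat.cast_nonneg L)
    have : 0 ≤ J * (k : ℝ) ^ 3 := by positivity
    nlinarith
  linarith

/-- The budget arithmetic of the telescope, over plain reals: the top step `16 c₄ − 8 d₄ ≤ c₁`,
Josephson at `k = 4` (`J (4/L)⁴ d₄ − 64 C J/L ≤ E`), the chain
(`ρ_K ≤ ρ₄ + E/(96J) + C K/L`), the floor (`r₀ − ε ≤ ρ_K`) and the size conditions `K ℓ ≤ L`,
`C/ℓ ≤ r₀/2`, `16 C/r₀ ≤ L`, `E ≤ κ = 3 J r₀`, `ε = r₀/8` give `r₀/8 ≤ c₁/L⁴`. [folklore] -/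
theorem budget_arith {c1 c4 d4 cK Kr Lr E J Cp r₀ ε κ ℓ : ℝ} (hJ : 0 < J) (hr₀ : 0 < r₀)
    (hL : 0 < Lr) (hℓ : 0 < ℓ) (hCp : 0 ≤ Cp)
    (htop : 16 * c4 - 8 * d4 ≤ c1)
    (hJ4 : J * (4 / Lr) ^ 4 * d4 - Cp * J * 4 ^ 3 / Lr ≤ E)
    (hchain : Kr ^ 2 / Lr ^ 4 * cK ≤ 4 ^ 2 / Lr ^ 4 * c4 + E / (96 * J) + Cp * Kr / Lr)
    (hfloor : r₀ - ε ≤ Kr ^ 2 / Lr ^ 4 * cK)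
    (hKℓ : Kr * ℓ ≤ Lr) (hCℓ : Cp / ℓ ≤ r₀ / 2) (hCL : 16 * Cp / r₀ ≤ Lr)
    (hEκ : E ≤ κ) (hκ : κ = 3 * J * r₀) (hε : ε = r₀ / 8) :
    r₀ / 8 ≤ c1 / Lr ^ 4 := by
  have hL4 : (0 : ℝ) < Lr ^ 4 := by positivity
  -- Josephson at k = 4 in density units
  have hkey : J * 256 * (d4 / Lr ^ 4) ≤ E + 64 * Cp * J / Lr := by
    have h1 : J * (4 / Lr) ^ 4 * d4 = J * 256 * (d4 / Lr ^ 4) := by rw [div_pow]; ring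
    have h2 : Cp * J * (4 : ℝ) ^ 3 / Lr = 64 * Cp * J / Lr := by ring
    linarith
  have hd4 : 8 * d4 / Lr ^ 4 ≤ E / (32 * J) + 2 * Cp / Lr := by
    have h32 : (0 : ℝ) < 32 * J := by positivity
    have h1 : 8 * d4 / Lr ^ 4 * (32 * J) ≤ E + 64 * Cp * J / Lr := by
      calc 8 * d4 / Lr ^ 4 * (32 * J) = J * 256 * (d4 / Lr ^ 4) := by ring
        _ ≤ E + 64 * Cp * J / Lr := hkey
    have h2 : (E / (32 * J) + 2 * Cp / Lr) * (32 * J) = E + 64 * Cp * J / Lr := by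
      field_simp
      ring
    nlinarith
  -- top step in density units
  have e1 : (4 : ℝ) ^ 2 / Lr ^ 4 * c4 ≤ c1 / Lr ^ 4 + 8 * d4 / Lr ^ 4 := by
    have h1 : (4 : ℝ) ^ 2 / Lr ^ 4 * c4 = (16 * c4) / Lr ^ 4 := by ring
    have h2 : c1 / Lr ^ 4 + 8 * d4 / Lr ^ 4 = (c1 + 8 * d4) / Lr ^ 4 := by ring
    rw [h1, h2]
    exact div_le_div_of_nonneg_right (by linarith) hL4.le
  -- slack of the chain
  have hKL : Cp * Kr / Lr ≤ Cp / ℓ := by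
    rw [div_le_div_iff₀ hL hℓ]
    nlinarith
  have hCL' : 2 * Cp / Lr ≤ r₀ / 8 := by
    rw [div_le_iff₀ hL]
    rw [div_le_iff₀ hr₀] at hCL
    linarith
  -- energy budget
  have e2 : E / (96 * J) ≤ κ / (96 * J) := div_le_div_of_nonneg_right hEκ (by positivity)
  have e3 : E / (32 * J) ≤ κ / (32 * J) := div_le_div_of_nonneg_right hEκ (by positivity)
  have e4 : κ / (96 * J) = r₀ / 32 := by
    rw [hκ, div_eq_iff (by positivity)]; ring
  have e5 : κ / (32 * J) = 3 * r₀ / 32 := by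
    rw [hκ, div_eq_iff (by positivity)]; ring
  rw [hε] at hfloor
  linarith

/-! ### The reduction -/

/-- **STUB `stub_reduction` of the line `Sketch` (the telescope's reduction; registered signature).**
At any point `(U, δ)`: the Josephson family for some `J > 0`, `C`, `ℓ₁ > 0`, and one coherence floor
`r₀ > 0` on an unbounded set of lattice scales, imply the matrix of `LowEnergyRigidity` at `(U, δ)`
(witnesses `κ = 3 J r₀`, `a = r₀/8`). Proof: pass to `C⁺ = max C 0`; pick a floor scale
`ℓ₀ ≥ max(ℓ₁, ⌈2C⁺/r₀⌉ + 1)` (so `C⁺/ℓ₀ ≤ r₀/2`), `ε = r₀/8`; at an even `L ≥ L₀` (all thresholds) and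
a unit sector vector `φ` with excess energy `E = Re⟨φ,Hφ⟩ − E₀ ∈ [0, κ]`, take the dyadic bottom count
`K = 4·2^m` with `K ℓ₀ ≤ L < 2Kℓ₀` (`exists_dyadic_window`); the floor applies because `κ ≤ c L²`;
combine `stub_topPoincare`, Josephson at `k = 4`, `stub_chain` and the floor through `budget_arith`.
[folklore] -/
theorem stub_reduction :
    ∀ (U δ : ℝ),
      (∃ J : ℝ, 0 < J ∧ ∃ C : ℝ, ∃ ℓ₁ : ℕ, 0 < ℓ₁ ∧ JosephsonInequalityAt U δ J C ℓ₁) →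
      (∃ r₀ : ℝ, 0 < r₀ ∧ ∀ n : ℕ, ∃ ℓ₀ : ℕ, n ≤ ℓ₀ ∧ CoherenceFloorAt U δ r₀ ℓ₀) →
      ∃ κ : ℝ, 0 < κ ∧ ∃ a : ℝ, 0 < a ∧ ∃ L₀ : ℕ, ∀ (L : ℕ) [NeZero L], L₀ ≤ L → Even L →
        ∀ φ : Fock (Orb (FermionTorus 2 L)),
          φ ∈ szSector (Λ := FermionTorus 2 L) (2 * ⌊(1 - δ) * (L : ℝ) ^ 2 / 2⌋₊) 0 →
          star φ ⬝ᵥ φ = 1 →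
          (star φ ⬝ᵥ Matrix.mulVec (hubbardTorus 2 L 1 U) φ).re ≤
              (hubbardTorus 2 L 1 U).minEnergyOn
                (szSector (Λ := FermionTorus 2 L) (2 * ⌊(1 - δ) * (L : ℝ) ^ 2 / 2⌋₊) 0) + κ →
          a ≤ (expect ((pairField dWaveFormFactor L)ᴴ * pairField dWaveFormFactor L) φ).re / (L : ℝ) ^ 4 := by
  intro U δ hJos hFloor
  obtain ⟨J, hJ, C, ℓ₁, hℓ₁, hJC⟩ := hJos
  -- pass to a nonnegative slack constant `Cp = max C 0`
  have hCp0 : (0 : ℝ) ≤ max C 0 := le_max_right _ _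
  obtain ⟨LJ, hJosL⟩ := josephsonInequalityAt_mono_slack hJ (le_max_left C 0) hJC
  obtain ⟨r₀, hr₀, hfl⟩ := hFloor
  -- a floor scale `ℓ₀ ≥ ℓ₁` with `Cp/ℓ₀ ≤ r₀/2`
  obtain ⟨ℓ₀, hℓ₀n, hF⟩ := hfl (max ℓ₁ (⌈2 * max C 0 / r₀⌉₊ + 1))
  have hℓ₁₀ : ℓ₁ ≤ ℓ₀ := le_trans (le_max_left _ _) hℓ₀n
  have hℓ₀pos : 0 < ℓ₀ := lt_of_lt_of_le hℓ₁ hℓ₁₀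
  have hℓ₀r : (0 : ℝ) < (ℓ₀ : ℝ) := by exact_mod_cast hℓ₀pos
  have hCℓ : max C 0 / (ℓ₀ : ℝ) ≤ r₀ / 2 := by
    have h1 : (⌈2 * max C 0 / r₀⌉₊ + 1 : ℕ) ≤ ℓ₀ := le_trans (le_max_right _ _) hℓ₀n
    have h2 : 2 * max C 0 / r₀ ≤ (ℓ₀ : ℝ) := by
      have := Nat.le_ceil (2 * max C 0 / r₀)
      have h3 : ((⌈2 * max C 0 / r₀⌉₊ : ℕ) : ℝ) + 1 ≤ (ℓ₀ : ℝ) := by exact_mod_cast h1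
      linarith
    rw [div_le_iff₀ hℓ₀r]
    rw [div_le_iff₀ hr₀] at h2
    linarith
  -- parameters `ε = r₀/8`, `κ = 3 J r₀`
  obtain ⟨c, hc, LF, hFloorL⟩ := hF (r₀ / 8) (by positivity)
  have hκpos : (0 : ℝ) < 3 * J * r₀ := by positivity
  refine ⟨3 * J * r₀, hκpos, r₀ / 8, by positivity,
    max (max LJ LF) (max (4 * ℓ₀) (max (⌈16 * max C 0 / r₀⌉₊ + 1) (⌈3 * J * r₀ / c⌉₊ + 1))), ?_⟩
  intro L _ hL hev φ hφK hφ1 hEnergy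
  -- unpack the size conditions
  have hLJ : LJ ≤ L := le_trans (le_trans (le_max_left _ _) (le_max_left _ _)) hL
  have hLF : LF ≤ L := le_trans (le_trans (le_max_right _ _) (le_max_left _ _)) hL
  have hL4 : 4 * ℓ₀ ≤ L := le_trans (le_trans (le_max_left _ _) (le_max_right _ _)) hL
  have hLC : ⌈16 * max C 0 / r₀⌉₊ + 1 ≤ L :=
    le_trans (le_trans (le_trans (le_max_left _ _) (le_max_right _ _)) (le_max_right _ _)) hL
  have hLκ : ⌈3 * J * r₀ / c⌉₊ + 1 ≤ L :=
    le_trans (le_trans (le_trans (le_max_right _ _) (le_max_right _ _)) (le_max_right _ _)) hL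
  have hLpos : (0 : ℝ) < (L : ℝ) := by
    have : 0 < L := lt_of_lt_of_le (by omega) hL4
    exact_mod_cast this
  -- Josephson at this `L`, every admissible `k`, as an energy bound at `φ`
  have hJk : ∀ (k : ℕ) [NeZero k], 4 ≤ k → k * ℓ₁ ≤ L →
      J * ((k : ℝ) / (L : ℝ)) ^ 4 * (expect (cellDirichlet L k) φ).re - max C 0 * J * (k : ℝ) ^ 3 / (L : ℝ) ≤
        (star φ ⬝ᵥ hubbardTorus 2 L 1 U *ᵥ φ).re -
          (hubbardTorus 2 L 1 U).minEnergyOn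
            (szSector (Λ := FermionTorus 2 L) (2 * ⌊(1 - δ) * (L : ℝ) ^ 2 / 2⌋₊) 0) :=
    fun k _ hk hkl => hJosL L hLJ hev k hk hkl φ hφK hφ1
  -- the excess energy is nonnegative (variational principle)
  have hE0 : (0 : ℝ) ≤ (star φ ⬝ᵥ hubbardTorus 2 L 1 U *ᵥ φ).re -
      (hubbardTorus 2 L 1 U).minEnergyOn
        (szSector (Λ := FermionTorus 2 L) (2 * ⌊(1 - δ) * (L : ℝ) ^ 2 / 2⌋₊) 0) :=
    sub_nonneg.mpr (minEnergyOn_le_re_rayleigh _ _ hφK hφ1)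
  -- the dyadic bottom count `4·2^m`
  obtain ⟨m, hKlo, hKhi⟩ := exists_dyadic_window hℓ₀pos hL4
  haveI : NeZero (4 * 2 ^ m) := ⟨by positivity⟩
  have hKℓ₁ : 4 * 2 ^ m * ℓ₁ ≤ L := le_trans (Nat.mul_le_mul_left _ hℓ₁₀) hKlo
  have hchain := stub_chain L J (max C 0) _ ℓ₁ φ hJ hCp0 hE0 hJk m hKℓ₁
  have htop := stub_topPoincare L φ
  have h4ℓ₁ : 4 * ℓ₁ ≤ L := le_trans (Nat.mul_le_mul_left _ hℓ₁₀) hL4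
  have hJ4 := hJk 4 (by norm_num) h4ℓ₁
  simp only [Nat.cast_ofNat] at hJ4
  -- the floor applies: `κ ≤ c L²`
  have hcL : 3 * J * r₀ ≤ c * (L : ℝ) ^ 2 := by
    have h1 : 3 * J * r₀ / c ≤ (L : ℝ) := by
      have := Nat.le_ceil (3 * J * r₀ / c)
      have h3 : ((⌈3 * J * r₀ / c⌉₊ : ℕ) : ℝ) + 1 ≤ (L : ℝ) := by exact_mod_cast hLκ
      linarith
    rw [div_le_iff₀ hc] at h1
    have h1L : (1 : ℝ) ≤ (L : ℝ) := by
      have : 1 ≤ L := le_trans (by omega) hLκ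
      exact_mod_cast this
    have h2 : c * (L : ℝ) ≤ c * (L : ℝ) ^ 2 := by
      apply mul_le_mul_of_nonneg_left _ hc.le
      nlinarith
    linarith
  have hEfl : (star φ ⬝ᵥ hubbardTorus 2 L 1 U *ᵥ φ).re ≤
      (hubbardTorus 2 L 1 U).minEnergyOn
        (szSector (Λ := FermionTorus 2 L) (2 * ⌊(1 - δ) * (L : ℝ) ^ 2 / 2⌋₊) 0) + c * (L : ℝ) ^ 2 := by
    linarith
  have hfloor := hFloorL L hLF hev (4 * 2 ^ m) hKlo hKhi φ hφK hφ1 hEfl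
  -- size conditions in real form
  have hKℓ : ((4 * 2 ^ m : ℕ) : ℝ) * (ℓ₀ : ℝ) ≤ (L : ℝ) := by exact_mod_cast hKlo
  have hCL : 16 * max C 0 / r₀ ≤ (L : ℝ) := by
    have := Nat.le_ceil (16 * max C 0 / r₀)
    have h3 : ((⌈16 * max C 0 / r₀⌉₊ : ℕ) : ℝ) + 1 ≤ (L : ℝ) := by exact_mod_cast hLC
    linarith
  have hEκ : (star φ ⬝ᵥ hubbardTorus 2 L 1 U *ᵥ φ).re -
      (hubbardTorus 2 L 1 U).minEnergyOn
        (szSector (Λ := FermionTorus 2 L) (2 * ⌊(1 - δ) * (L : ℝ) ^ 2 / 2⌋₊) 0) ≤ 3 * J * r₀ := by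
    linarith
  exact budget_arith hJ hr₀ hLpos hℓ₀r hCp0 htop hJ4 hchain hfloor hKℓ hCℓ hCL hEκ rfl rfl

/-- **The crux BY NAME from the two open inputs** (`lowEnergyRigidity_of_josephson_of_floor`): at a
point `0 < U`, `δ ∈ (0, 1/2)`, the Josephson family (some `J > 0`, `C`, `ℓ₁ > 0`) and one coherence
floor `r₀ > 0` on an unbounded set of lattice scales give
`Summit.HubbardSuperconductivity.HubbardSuperconductivity.Theses.DeformationLadder.LowEnergyRigidity`
(by `stub_reduction`). A CONDITIONAL result: both inputs are conjecture-grade (card poincare-telescope,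
open inputs 1 and 2); nothing is claimed about them here. [folklore] -/
theorem lowEnergyRigidity_of_josephson_of_floor {U δ : ℝ} (hU : 0 < U) (hδ : δ ∈ Set.Ioo (0 : ℝ) (1 / 2))
    (hJos : ∃ J : ℝ, 0 < J ∧ ∃ C : ℝ, ∃ ℓ₁ : ℕ, 0 < ℓ₁ ∧ JosephsonInequalityAt U δ J C ℓ₁)
    (hFloor : ∃ r₀ : ℝ, 0 < r₀ ∧ ∀ n : ℕ, ∃ ℓ₀ : ℕ, n ≤ ℓ₀ ∧ CoherenceFloorAt U δ r₀ ℓ₀) :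
    LowEnergyRigidity := by
  obtain ⟨κ, hκ, a, ha, L₀, h⟩ := stub_reduction U δ hJos hFloor
  exact ⟨U, hU, δ, hδ, κ, hκ, a, ha, L₀, fun L _ hL hev φ hφK hφ1 hE => h L hL hev φ hφK hφ1 hE⟩

end Summit.HubbardSuperconductivity.HubbardSuperconductivity.Theorems.LowEnergyRigidity.Telescope
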